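import Mathlib
import Summits.PneNP.PneNP.Theorems.Nc03AvoidResidualCoreReductionBfsP5
import Summits.PneNP.PneNP.Theorems.Nc03AvoidResidualCoreReductionMajC
import Literature.Computability.Complexity.IoAvgHardMachine

/-!
# Route Nc03AvoidResidualCore, item `ResidualCoreReduction` — the solver, XIV: class `6` (`MAJ₃`)

Helper file for `stmt-PneNP-20227` (sequel of `…ReductionBfsP5`, `…ReductionMajC`; cell pnp-ideate).
The polynomial-time solver for the pure `MAJ₃` class: the graph data `gd6` of the junction multigraph
`G6 J` computed from the raw instance, the packed part `P6P` (= `P6 J`), the bichromaticity test,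
and the search over the candidates `(e, b)` for one whose pattern `flipCol (P6 J) e b` is
bichromatic — which exists when `5N < M` (`cert6_exists`) and is outside the range
(`cert6_sound`). `sol6_correct`, `codeFP_sol6`.
-/

set_option linter.dupNamespace false -- `Summit.PneNP.PneNP.…`: summit = sub-problem name (D-0017 single-conjunct layout)

namespace Summit.PneNP.PneNP.Theorems.Nc03Reduction

open Literature.Computability.Complexity CodeFP

variable {N M : ℕ}

/-! ## Programs -/

/-- The graph data of the junction multigraph: vertex `2a` for role `0`, `2b + 1` for role `1`. -/
def gd6 (pr : PRaw) : GD := (2 * pr.1, (enumT pr).map fun x => (x.1, 2 * x.2.1, 2 * x.2.2.1 + 1))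

/-- The bit string of all outputs. -/
def allP (gd : GD) : List Bool := (List.range (mP gd)).map fun _ => true

/-- The packed part of the junction multigraph. -/
def P6P (pr : PRaw) : List Bool := packUnionP (gd6 pr) (allP (gd6 pr))

/-- The bichromaticity test: two outputs of `P` with the same role-`2` variable and different bits. -/
def bichromP (pr : PRaw) (P y : List Bool) : Bool :=
  (enumT pr).any fun x => (enumT pr).any fun x' =>
    P.getD x.1 false && P.getD x'.1 false && decide (x.2.2.2 = x'.2.2.2) && y.getD x.1 false && !y.getD x'.1 false

/-- The candidates `(e, b)`. -/
def cands6 (pr : PRaw) : List (ℕ × Bool) := (List.range (mP (gd6 pr))).product [false, true]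

/-- The test on a candidate: a non-forest edge of the packed part with a bichromatic pattern. -/
def test6 (pr : PRaw) (eb : ℕ × Bool) : Bool :=
  (P6P pr).getD eb.1 false && !inForestP (gd6 pr) (P6P pr) eb.1 &&
    bichromP pr (P6P pr) (flipColP (gd6 pr) (P6P pr) eb.1 eb.2)

/-- Solver, class `6`: the pattern of the first good candidate (zeros if none). -/
def sol6 (pr : PRaw) : List Bool :=
  ((cands6 pr).find? (test6 pr)).elim (zerosP (gd6 pr)) fun eb => flipColP (gd6 pr) (P6P pr) eb.1 eb.2

/-! ## Agreement and correctness -/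

section Correct

variable (J : LocalMap 3 N M)

/-- The enumeration of a genuine instance as a tabulated list. -/
theorem enumT_rawOf : enumT (rawOf J) = List.ofFn fun p : Fin M => (p.val, tripOf J p) := by
  unfold enumT; rw [rawOf_eq]
  apply List.ext_getElem
  · simp
  · intro i h1 h2
    rw [List.getElem_zip, List.getElem_range, List.getElem_ofFn, List.getElem_ofFn]

/-- **The program's graph data is the junction multigraph's graph data.** -/
theorem gd6_rawOf : gd6 (rawOf J) = gdOf (G6 J) := by
  unfold gd6 gdOf
  rw [rawOf_N, enumT_rawOf, List.map_ofFn]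
  rfl

/-- Reading the bichromaticity test. -/
theorem bichromP_iff {P : Finset (Fin M)} {PL : List Bool} (hP : RepE P PL) {y' : Fin M → Bool} {yl : List Bool}
    (hy : ∀ j : Fin M, yl.getD j.val false = y' j) : bichromP (rawOf J) PL yl = true ↔ Bichrom J P y' := by
  unfold bichromP Bichrom
  simp only [List.any_eq_true, Bool.and_eq_true, Bool.not_eq_true', decide_eq_true_eq]
  constructor
  · rintro ⟨x, hx, x', hx', ⟨⟨⟨h1, h2⟩, h3⟩, h4⟩, h5⟩
    obtain ⟨p, rfl⟩ := (mem_enumT_iff J).1 hx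
    obtain ⟨p', rfl⟩ := (mem_enumT_iff J).1 hx'
    simp only [tripOf_snd_snd] at h3
    rw [hP p, decide_eq_true_eq] at h1
    rw [hP p', decide_eq_true_eq] at h2
    rw [hy p] at h4; rw [hy p'] at h5
    exact ⟨p, h1, p', h2, Fin.ext h3, h4, h5⟩
  · rintro ⟨p, h1, p', h2, h3, h4, h5⟩
    refine ⟨_, mem_enumT J p, _, mem_enumT J p', ⟨⟨⟨?_, ?_⟩, ?_⟩, ?_⟩, ?_⟩
    · rw [hP p]; exact decide_eq_true h1
    · rw [hP p']; exact decide_eq_true h2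
    · simp only [tripOf_snd_snd]; exact congrArg Fin.val h3
    · rw [hy p]; exact h4
    · rw [hy p']; exact h5

/-- Members of the candidate list. -/
theorem mem_cands6 {e : ℕ} {b : Bool} : (e, b) ∈ cands6 (rawOf J) ↔ e < M := by
  unfold cands6
  rw [gd6_rawOf, mP_gdOf, List.pair_mem_product, List.mem_range]
  constructor
  · exact fun h => h.1
  · intro h; exact ⟨h, by cases b <;> simp⟩

/-- Output length, class `6`. -/
theorem length_sol6 : (sol6 (rawOf J)).length = M := by
  unfold sol6
  rw [gd6_rawOf]
  cases (cands6 (rawOf J)).find? (test6 (rawOf J)) with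
  | none => simp [zerosP, mP_gdOf]
  | some eb => exact length_flipColP _ _ _

/-- The all-ones bit string represents all outputs. -/
theorem allP_rep : RepE (Finset.univ : Finset (Fin M)) (allP (gdOf (G6 J))) := by
  intro j
  unfold allP
  rw [getD_map_range]; simp

variable [NeZero M]

/-- **The packed part bit string represents `P6`.** -/
theorem P6P_rep : RepE (P6 J) (P6P (rawOf J)) := by
  unfold P6P P6; rw [gd6_rawOf]; exact packUnionP_rep (allP_rep J)

/-- Reading the candidate test. -/
theorem test6_iff (e : Fin M) (b : Bool) :
    test6 (rawOf J) (e.val, b) = true ↔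
      e ∈ P6 J ∧ e ∉ (G6 J).forest (P6 J) ∧ Bichrom J (P6 J) ((G6 J).flipCol (P6 J) e b) := by
  have hP := P6P_rep J
  unfold test6
  rw [Bool.and_eq_true, Bool.and_eq_true, Bool.not_eq_true', hP e, decide_eq_true_eq, gd6_rawOf,
    Bool.eq_false_iff, ne_eq, inForestP_iff hP]
  constructor
  · rintro ⟨⟨he, hf⟩, hb⟩
    exact ⟨he, hf, (bichromP_iff J hP (fun j => flipColP_eq hP he b j)).1 hb⟩
  · rintro ⟨he, hf, hb⟩
    exact ⟨⟨he, hf⟩, (bichromP_iff J hP (fun j => flipColP_eq hP he b j)).2 hb⟩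

/-- **Correctness, class `6`.** -/
theorem sol6_correct (hP : J.IsPure (rep 6)) (hM : 5 * N < M) :
    (fun p : Fin M => (sol6 (rawOf J)).getD p.val false) ∉ J.range := by
  obtain ⟨e, heP, heT, b, hb⟩ := cert6_exists J hM
  have hx₀ : test6 (rawOf J) (e.val, b) = true := (test6_iff J e b).2 ⟨heP, heT, hb⟩
  have hmem : (e.val, b) ∈ cands6 (rawOf J) := (mem_cands6 J).2 e.isLt
  cases h : (cands6 (rawOf J)).find? (test6 (rawOf J)) with
  | none => exact absurd hx₀ (by have := List.find?_eq_none.1 h _ hmem; simpa using this)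
  | some eb =>
    obtain ⟨e', b'⟩ := eb
    have hx := List.find?_some h
    have he' : e' < M := (mem_cands6 J).1 (List.mem_of_find?_eq_some h)
    obtain ⟨heP', heT', hb'⟩ := (test6_iff J ⟨e', he'⟩ b').1 hx
    have hsol : sol6 (rawOf J) = flipColP (gdOf (G6 J)) (P6P (rawOf J)) e' b' := by
      unfold sol6; rw [h, gd6_rawOf]; rfl
    have hfun : (fun p : Fin M => (sol6 (rawOf J)).getD p.val false) = (G6 J).flipCol (P6 J) ⟨e', he'⟩ b' := by
      funext p; rw [hsol]; exact flipColP_eq (P6P_rep J) heP' b' p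
    rw [hfun]
    exact cert6_sound hP heP' heT' b' hb'

end Correct

/-! ## Polynomial time -/

/-- The graph data is polynomial time. -/
theorem codeFP_gd6 : CodeFP prE gdE gd6 := by
  have hitem : CodeFP etE tripE (fun x : ETrip => (x.1, 2 * x.2.1, 2 * x.2.2.1 + 1)) :=
    ((fst _ _).pair (((natMul.comp ((const _ 2).pair (snd _ _).fst')).pair
      (natAdd.comp ((natMul.comp ((const _ 2).pair (snd _ _).snd'.fst')).pair (const _ 1)))))).congr fun _ => rfl
  exact (((unMulConst 2).comp codeFP_N).pair ((map₀ hitem).comp codeFP_enumT)).congr fun _ => rfl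

/-- The all-ones bit string is polynomial time. -/
theorem codeFP_allP : CodeFP gdE strE allP :=
  (bitsToStr.comp ((map (σ := GD) (eσ := gdE) (g := fun _ => true) (const _ true)).comp
    ((CodeFP.id _).pair (urange.comp codeFP_mP)))).congr fun _ => rfl

/-- The zero bit string is polynomial time. -/
theorem codeFP_zerosP : CodeFP gdE strE zerosP :=
  (bitsToStr.comp ((map (σ := GD) (eσ := gdE) (g := fun _ => false) (const _ false)).comp
    ((CodeFP.id _).pair (urange.comp codeFP_mP)))).congr fun _ => rfl

/-- The packed part is polynomial time. -/
theorem codeFP_P6P : CodeFP prE strE P6P :=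
  (codeFP_packUnionP.comp (codeFP_gd6.pair (codeFP_allP.comp codeFP_gd6))).congr fun _ => rfl

/-- The bichromaticity test is polynomial time. -/
theorem codeFP_bichromP : CodeFP (pairE prE (pairE strE strE)) bitE (fun q => bichromP q.1 q.2.1 q.2.2) := by
  -- inner item: context `((q, x), x')`
  have hin : CodeFP (pairE (pairE (pairE prE (pairE strE strE)) etE) etE) bitE
      (fun y => y.1.1.2.1.getD y.1.2.1 false && y.1.1.2.1.getD y.2.1 false && decide (y.1.2.2.2.2 = y.2.2.2.2) &&
        y.1.1.2.2.getD y.1.2.1 false && !y.1.1.2.2.getD y.2.1 false) :=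
    (((((strGetDNat.comp ((fst _ _).fst'.snd'.fst'.pair (fst _ _).snd'.fst')).and
      (strGetDNat.comp ((fst _ _).fst'.snd'.fst'.pair (snd _ _).fst'))).and
      (codeFP_eqTest (fst _ _).snd'.snd'.snd'.snd' (snd _ _).snd'.snd'.snd')).and
      (strGetDNat.comp ((fst _ _).fst'.snd'.snd'.pair (fst _ _).snd'.fst'))).and
      (strGetDNat.comp ((fst _ _).fst'.snd'.snd'.pair (snd _ _).fst')).not).congr fun _ => rfl
  have hmid : CodeFP (pairE (pairE prE (pairE strE strE)) etE) bitE
      (fun z => (enumT z.1.1).any fun x' => z.1.2.1.getD z.2.1 false && z.1.2.1.getD x'.1 false &&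
        decide (z.2.2.2.2 = x'.2.2.2) && z.1.2.2.getD z.2.1 false && !z.1.2.2.getD x'.1 false) :=
    ((any hin).comp ((CodeFP.id _).pair (codeFP_enumT.comp (fst _ _).fst'))).congr fun _ => rfl
  exact ((any hmid).comp ((CodeFP.id _).pair (codeFP_enumT.comp (fst _ _)))).congr fun _ => rfl

/-- The candidate test is polynomial time. -/
theorem codeFP_test6 : CodeFP (pairE prE (pairE natE bitE)) bitE (fun q => test6 q.1 q.2) := by
  have hgd : CodeFP (pairE prE (pairE natE bitE)) gdE (fun q => gd6 q.1) := codeFP_gd6.comp (fst _ _)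
  have hP : CodeFP (pairE prE (pairE natE bitE)) strE (fun q => P6P q.1) := codeFP_P6P.comp (fst _ _)
  have hce : CodeFP (pairE prE (pairE natE bitE)) ceE (fun q => (gd6 q.1, P6P q.1)) := hgd.pair hP
  have h1 : CodeFP (pairE prE (pairE natE bitE)) bitE (fun q => (P6P q.1).getD q.2.1 false) :=
    (strGetDNat.comp (hP.pair (snd _ _).fst')).congr fun _ => rfl
  have h2 : CodeFP (pairE prE (pairE natE bitE)) bitE (fun q => inForestP (gd6 q.1) (P6P q.1) q.2.1) :=
    (codeFP_inForestP.comp (hce.pair (snd _ _).fst')).congr fun _ => rfl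
  have hy : CodeFP (pairE prE (pairE natE bitE)) strE (fun q => flipColP (gd6 q.1) (P6P q.1) q.2.1 q.2.2) :=
    (codeFP_flipColP.comp ((hce.pair (snd _ _).fst').pair (snd _ _).snd')).congr fun _ => rfl
  have h3 : CodeFP (pairE prE (pairE natE bitE)) bitE
      (fun q => bichromP q.1 (P6P q.1) (flipColP (gd6 q.1) (P6P q.1) q.2.1 q.2.2)) :=
    (codeFP_bichromP.comp ((fst _ _).pair (hP.pair hy))).congr fun _ => rfl
  exact ((h1.and h2.not).and h3).congr fun _ => rfl

/-- The candidate list is polynomial time. -/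
theorem codeFP_cands6 : CodeFP prE (rawE (pairE natE bitE)) cands6 :=
  ((rawProduct natE bitE).comp ((urange.comp (codeFP_mP.comp codeFP_gd6)).pair
    (const _ [false, true]))).congr fun _ => rfl

/-- **Polynomial time, class `6`.** -/
theorem codeFP_sol6 : CodeFP prE (rawE bitE) sol6 := by
  have hfind : CodeFP prE (optE (pairE natE bitE)) (fun pr => (cands6 pr).find? (test6 pr)) :=
    ((rawFind? (σ := PRaw) (eσ := prE) (p := fun q => test6 q.1 q.2) codeFP_test6).comp
      ((CodeFP.id _).pair codeFP_cands6)).congr fun _ => rfl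
  have hsome : CodeFP (pairE prE (pairE natE bitE)) strE (fun q => flipColP (gd6 q.1) (P6P q.1) q.2.1 q.2.2) :=
    (codeFP_flipColP.comp ((((codeFP_gd6.comp (fst _ _)).pair (codeFP_P6P.comp (fst _ _))).pair
      (snd _ _).fst').pair (snd _ _).snd')).congr fun _ => rfl
  have hk := optCases (σ := PRaw) (eσ := prE) (eα := pairE natE bitE) (eδ := strE)
    (k := fun pr o => o.elim (zerosP (gd6 pr)) fun eb => flipColP (gd6 pr) (P6P pr) eb.1 eb.2)
    (gnone := fun pr => zerosP (gd6 pr)) (gsome := fun q => flipColP (gd6 q.1) (P6P q.1) q.2.1 q.2.2)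
    (codeFP_zerosP.comp codeFP_gd6) hsome (fun _ => rfl) (fun _ _ => rfl)
  have h : CodeFP prE strE sol6 := (hk.comp ((CodeFP.id prE).pair hfind)).congr (fun pr => by unfold sol6; rfl)
  exact (IoHard.codeFP_strToRaw.comp h).congr fun _ => rfl

end Summit.PneNP.PneNP.Theorems.Nc03Reduction
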